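import Mathlib
import HarnessLib
import Summits.Ventures.LatticeQCDFlow.Exactness.KernelCouplingMask
import Summits.Ventures.LatticeQCDFlow.Exactness.NCPLayerEquiv

/-!
# `U(1)` plaquette coupling layers with ANY `C¹` degree-one kernel — in particular the engine's NCP mixtures — are exact measurable automorphisms of the gauge-field space

HONEST FRAMING: exact (Metropolis-corrected) sampling algorithms for lattice gauge theory;
figures of merit are autocorrelation/cost numbers at stated couplings and volumes; no
continuum-physics claim.

Venture `LatticeQCDFlow` (cell pub-lqcd), topic `Exactness`; FANOUT row 10 (`eng-equiv`, engine
`latflow.equiv` `equiv/u1.py` "Kanwar NCP/spline plaquette couplings" — this file: the NCP half and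
the common generic statement; the spline half is `U1SplinePlaquetteCouplingLayer` /
`U1SplinePlaquetteCouplingEquiv`).  NEW WORK of the cell, an assembly of tree files:
`KernelCouplingMask` (`plaquetteKernelLayer_eq_coupleFun`, `hasJacobian_plaquetteKernelLayer`: a
plaquette kernel layer with frozen staples is `Theory2.coupleFun`, exact with the kernels' densities
at the loops), row 14's `CircleGroupJacobian` (`hasJacobian_circleGroup_of_degreeOne`),
`DegreeOneLayerEquiv` (`exists_coupleEquiv_of_hasDerivAt_pos`), `NCPCircleJacobian` /
`NCPLayerEquiv` (the NCP-mixture lift: derivative, positivity, degree one, joint measurability)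
and row 31's `Theory2.coupleEquiv`.  Nothing is cited as a fact; no number; no definition.  Printed
counterpart, NAMED ONLY: Kanwar et al., PRL 125 (2020) 121601 (plaquette coupling layers whose
kernel is a mixture of non-compact projections `tan(θ/2) ↦ e^s tan(θ/2)`).

## Content

* **`hasJacobian_u1DegreeOnePlaquetteCouplingLayer`** — GENERIC: on `GaugeConfig d L Circle` with
  `⊗ haarProbability Circle`, a mask `p` / plane choice `ν` with frozen staples, and per active link
  a kernel `H e y (e^{iθ}) = e^{iΦ e y θ}` given by a `C¹` degree-one lift `Φ e y` with positive
  continuous derivative `Φ' e y`, both jointly measurable in (frozen links, angle): the plaquette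
  coupling layer `V e ↦ H(P) P⁻¹ V e` has `HasJacobian (⊗ Haar) layer (ofReal ∘ coupleJac p (Φ' at the plaquette angle))`;
* **`exists_measurableEquiv_u1DegreeOnePlaquetteCouplingLayer`** — the same layer is
  `⇑Ψ` for a `Ψ : GaugeConfig d L Circle ≃ᵐ GaugeConfig d L Circle` with that `HasJacobian`;
* **`hasJacobian_u1NCPPlaquetteCouplingLayer`**, **`exists_measurableEquiv_u1NCPPlaquetteCouplingLayer`**
  — the engine's NCP-mixture plaquette coupling (convex weights, positive scales, offsets, shift
  measurable in the frozen links) with its booked density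
  `Σ_i w_i · 2l_i/((1 + l_i²) + (1 − l_i²) cos(θ_P − a_i))`.
-/

noncomputable section

namespace Summit.Ventures.LatticeQCDFlow.Exactness

open Real Set Function MeasureTheory Summit.Ventures.LatticeQCDFlow.Theory2
open Literature.MathematicalPhysics.QuantumFieldTheory
open scoped ENNReal

section Generic

variable {d L : ℕ} [NeZero L]
  (p : Edge d L → Prop) [DecidablePred p] (ν : Edge d L → Fin d)
  (h1 : ∀ e, p e → ¬p (e.1.shift e.2, ν e)) (h2 : ∀ e, p e → ¬p (e.1.shift (ν e), e.2))
  (h3 : ∀ e, p e → ¬p (e.1, ν e))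
  {Φ Φ' : Edge d L → ({f : Edge d L // ¬p f} → Circle) → ℝ → ℝ}
  (hderiv : ∀ e y θ, HasDerivAt (Φ e y) (Φ' e y θ) θ) (hcont : ∀ e y, Continuous (Φ' e y))
  (hpos : ∀ e y θ, 0 < Φ' e y θ) (hdeg : ∀ e y θ, Φ e y (θ + 2 * π) = Φ e y θ + 2 * π)
  (hΦm : ∀ e, Measurable fun w : ℝ × ({f : Edge d L // ¬p f} → Circle) => Φ e w.2 w.1)
  (hΦ'm : ∀ e, Measurable fun w : ℝ × ({f : Edge d L // ¬p f} → Circle) => Φ' e w.2 w.1)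
  (hol : GaugeConfig d L Circle → Edge d L → Circle → Circle)
  (H : Edge d L → ({f : Edge d L // ¬p f} → Circle) → Circle → Circle)
  (hHV : ∀ (V : GaugeConfig d L Circle) (e : Edge d L), p e → hol V e = H e (fun f => V f))
  (hH : ∀ e y (θ : ℝ), H e y (Circle.exp θ) = Circle.exp (Φ e y θ))
  (j : Edge d L → ({f : Edge d L // ¬p f} → Circle) → Circle → ℝ)
  (hj : ∀ e y (θ : ℝ), j e y (Circle.exp θ) = Φ' e y θ)

include hderiv hcont hpos hdeg hΦm hΦ'm hHV hH hj in
/-- **`U(1)` plaquette coupling layers with `C¹` degree-one kernels are exact.**  Lattice `(ℤ/L)^d`,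
links in `U(1) = Circle`, reference `⊗ haarProbability Circle`; mask `p` and plane choice `ν` with the
three staple links of every active plaquette frozen (`h1`–`h3`); kernel field `hol V e = H e (V|frozen)`
with `H e y (e^{iθ}) = e^{iΦ e y θ}` for lifts `Φ e y` (`C¹`, positive continuous derivative `Φ' e y`,
degree one, jointly measurable); density `j e y (e^{iθ}) = Φ' e y θ`.  Then the layer
`V e ↦ hol V e (P) P⁻¹ V e` (active), `V e` (frozen) has
`HasJacobian (⊗ Haar) layer (ofReal ∘ Theory2.coupleJac p (j at the plaquettes))`. -/
theorem hasJacobian_u1DegreeOnePlaquetteCouplingLayer :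
    HasJacobian (MeasureTheory.Measure.pi fun _ : Edge d L => haarProbability Circle)
      (fun (V : GaugeConfig d L Circle) (e : Edge d L) =>
        if p e then hol V e (plaquetteHolonomy V e.1 e.2 (ν e)) *
          (plaquetteHolonomy V e.1 e.2 (ν e))⁻¹ * V e
        else V e)
      fun V => ENNReal.ofReal (Theory2.coupleJac p (fun a y u =>
        j a.1 y (u * (y ⟨_, h1 a.1 a.2⟩ * (y ⟨_, h2 a.1 a.2⟩)⁻¹ * (y ⟨_, h3 a.1 a.2⟩)⁻¹))) V) := by
  have hHm : ∀ e, Measurable fun q : Circle × ({f : Edge d L // ¬p f} → Circle) => H e q.2 q.1 := by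
    intro e
    refine Circle.measurable_of_measurable_comp_exp_prod ?_
    simp_rw [hH]
    exact Circle.exp.continuous.measurable.comp (hΦm e)
  have hjm : ∀ e, Measurable fun q : Circle × ({f : Edge d L // ¬p f} → Circle) => j e q.2 q.1 := by
    intro e
    refine Circle.measurable_of_measurable_comp_exp_prod ?_
    simp_rw [hj]
    exact hΦ'm e
  have hev : ∀ f₀ : {f : Edge d L // ¬p f}, Measurable fun y : ({f : Edge d L // ¬p f} → Circle) => y f₀ :=
    fun f₀ => measurable_pi_apply f₀
  have hS : ∀ a : {e // p e}, Measurable fun y : ({f : Edge d L // ¬p f} → Circle) =>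
      y ⟨_, h1 a.1 a.2⟩ * (y ⟨_, h2 a.1 a.2⟩)⁻¹ * (y ⟨_, h3 a.1 a.2⟩)⁻¹ := fun a =>
    ((hev _).mul (hev _).inv).mul (hev _).inv
  have hloop : ∀ a : {e // p e}, Measurable fun q : Circle × ({f : Edge d L // ¬p f} → Circle) =>
      q.1 * (q.2 ⟨_, h1 a.1 a.2⟩ * (q.2 ⟨_, h2 a.1 a.2⟩)⁻¹ * (q.2 ⟨_, h3 a.1 a.2⟩)⁻¹) := fun a =>
    measurable_fst.mul ((hS a).comp measurable_snd)
  refine hasJacobian_plaquetteKernelLayer p ν hol H j hHV h1 h2 h3 (fun a => ?_) (fun a => ?_)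
    (fun a y => ?_) (fun a y z => ?_)
  · exact (((hHm a.1).comp ((hloop a).prodMk measurable_snd)).mul (hloop a).inv).mul measurable_fst
  · exact (hjm a.1).comp ((hloop a).prodMk measurable_snd)
  · exact hasJacobian_circleGroup_of_degreeOne (hderiv a.1 y) (hcont a.1 y) (hpos a.1 y) (hdeg a.1 y)
      (hH a.1 y) (fun θ => by simp only [hj])
  · obtain ⟨θ, rfl⟩ := Circle.exp_surjective z
    rw [hj]
    exact (hpos a.1 y θ).le

include hderiv hcont hpos hdeg hΦm hΦ'm hHV hH hj in
/-- **… and they are measurable automorphisms of the gauge-field space.**  Under the same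
hypotheses there is `Ψ : GaugeConfig d L Circle ≃ᵐ GaugeConfig d L Circle` whose forward map IS the
layer, with `HasJacobian (⊗ Haar) Ψ (ofReal ∘ coupleJac p j)`; the inverse (never evaluated by a
sampler, needed for exactness of the reported chain) is the coupling layer of the inverse kernels. -/
theorem exists_measurableEquiv_u1DegreeOnePlaquetteCouplingLayer :
    ∃ Ψ : GaugeConfig d L Circle ≃ᵐ GaugeConfig d L Circle,
      (⇑Ψ = fun (V : GaugeConfig d L Circle) (e : Edge d L) =>
        if p e then hol V e (plaquetteHolonomy V e.1 e.2 (ν e)) *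
          (plaquetteHolonomy V e.1 e.2 (ν e))⁻¹ * V e
        else V e) ∧
      HasJacobian (MeasureTheory.Measure.pi fun _ : Edge d L => haarProbability Circle) Ψ
        fun V => ENNReal.ofReal (Theory2.coupleJac p (fun a y u =>
          j a.1 y (u * (y ⟨_, h1 a.1 a.2⟩ * (y ⟨_, h2 a.1 a.2⟩)⁻¹ * (y ⟨_, h3 a.1 a.2⟩)⁻¹))) V) := by
  -- single-link measurable equivalences realising the kernels
  obtain ⟨φe, hφe, hφem, hφesm⟩ := exists_coupleEquiv_of_hasDerivAt_pos (p := p)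
    (Φ := fun a y => Φ a.1 y) (Φ' := fun a y => Φ' a.1 y)
    (fun a y θ => hderiv a.1 y θ) (fun a y θ => hpos a.1 y θ) (fun a y θ => hdeg a.1 y θ) (fun a => hΦm a.1)
  have hHφ : ∀ (a : {e // p e}) y (u : Circle), H a.1 y u = φe a y u := by
    intro a y u
    obtain ⟨θ, rfl⟩ := Circle.exp_surjective u
    rw [hH, hφe]
  -- the staple and the loop
  have hev : ∀ f₀ : {f : Edge d L // ¬p f}, Measurable fun y : ({f : Edge d L // ¬p f} → Circle) => y f₀ :=
    fun f₀ => measurable_pi_apply f₀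
  have hS : ∀ a : {e // p e}, Measurable fun y : ({f : Edge d L // ¬p f} → Circle) =>
      y ⟨_, h1 a.1 a.2⟩ * (y ⟨_, h2 a.1 a.2⟩)⁻¹ * (y ⟨_, h3 a.1 a.2⟩)⁻¹ := fun a =>
    ((hev _).mul (hev _).inv).mul (hev _).inv
  have hloop : ∀ a : {e // p e}, Measurable fun q : Circle × ({f : Edge d L // ¬p f} → Circle) =>
      q.1 * (q.2 ⟨_, h1 a.1 a.2⟩ * (q.2 ⟨_, h2 a.1 a.2⟩)⁻¹ * (q.2 ⟨_, h3 a.1 a.2⟩)⁻¹) := fun a =>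
    measurable_fst.mul ((hS a).comp measurable_snd)
  -- conjugating by the frozen staple translation: `u ↦ φ(uS) S⁻¹`
  set ψ : {e // p e} → ({f : Edge d L // ¬p f} → Circle) → Circle ≃ᵐ Circle := fun a y =>
    { toFun := fun u => φe a y (u * (y ⟨_, h1 a.1 a.2⟩ * (y ⟨_, h2 a.1 a.2⟩)⁻¹ * (y ⟨_, h3 a.1 a.2⟩)⁻¹)) *
        (y ⟨_, h1 a.1 a.2⟩ * (y ⟨_, h2 a.1 a.2⟩)⁻¹ * (y ⟨_, h3 a.1 a.2⟩)⁻¹)⁻¹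
      invFun := fun v => (φe a y).symm (v * (y ⟨_, h1 a.1 a.2⟩ * (y ⟨_, h2 a.1 a.2⟩)⁻¹ * (y ⟨_, h3 a.1 a.2⟩)⁻¹)) *
        (y ⟨_, h1 a.1 a.2⟩ * (y ⟨_, h2 a.1 a.2⟩)⁻¹ * (y ⟨_, h3 a.1 a.2⟩)⁻¹)⁻¹
      left_inv := fun u => by
        simp only [inv_mul_cancel_right, MeasurableEquiv.symm_apply_apply, mul_inv_cancel_right]
      right_inv := fun v => by
        simp only [inv_mul_cancel_right, MeasurableEquiv.apply_symm_apply, mul_inv_cancel_right]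
      measurable_toFun := ((φe a y).measurable.comp (measurable_id.mul_const _)).mul_const _
      measurable_invFun := ((φe a y).symm.measurable.comp (measurable_id.mul_const _)).mul_const _ }
    with hψdef
  have hψm : ∀ a, Measurable fun q : Circle × ({f : Edge d L // ¬p f} → Circle) => ψ a q.2 q.1 := fun a =>
    ((hφem a).comp ((hloop a).prodMk measurable_snd)).mul ((hS a).comp measurable_snd).inv
  have hψsm : ∀ a, Measurable fun q : Circle × ({f : Edge d L // ¬p f} → Circle) => (ψ a q.2).symm q.1 :=
    fun a => ((hφesm a).comp ((hloop a).prodMk measurable_snd)).mul ((hS a).comp measurable_snd).inv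
  have hbridge := plaquetteKernelLayer_eq_coupleFun p ν hol H hHV h1 h2 h3
  have hψeq : (fun (a : {e // p e}) (y : {f : Edge d L // ¬p f} → Circle) (u : Circle) =>
      H a.1 y (u * (y ⟨_, h1 a.1 a.2⟩ * (y ⟨_, h2 a.1 a.2⟩)⁻¹ * (y ⟨_, h3 a.1 a.2⟩)⁻¹)) *
        (u * (y ⟨_, h1 a.1 a.2⟩ * (y ⟨_, h2 a.1 a.2⟩)⁻¹ * (y ⟨_, h3 a.1 a.2⟩)⁻¹))⁻¹ * u) =
      fun a y u => ψ a y u := by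
    funext a y u
    rw [hHφ, mul_assoc, mul_inv_rev, inv_mul_cancel_right]
    rfl
  refine ⟨coupleEquiv ψ hψm hψsm, ?_, ?_⟩
  · rw [coe_coupleEquiv, hbridge, hψeq]
  · rw [coe_coupleEquiv, ← hψeq, ← hbridge]
    exact hasJacobian_u1DegreeOnePlaquetteCouplingLayer p ν h1 h2 h3 hderiv hcont hpos hdeg hΦm hΦ'm hol H
      hHV hH j hj

end Generic

/-! ## The engine's NCP-mixture plaquette coupling -/

section NCP

variable {d L : ℕ} [NeZero L] {m : ℕ}
  (p : Edge d L → Prop) [DecidablePred p] (ν : Edge d L → Fin d)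
  (h1 : ∀ e, p e → ¬p (e.1.shift e.2, ν e)) (h2 : ∀ e, p e → ¬p (e.1.shift (ν e), e.2))
  (h3 : ∀ e, p e → ¬p (e.1, ν e))
  (w a l : Edge d L → ({f : Edge d L // ¬p f} → Circle) → Fin m → ℝ)
  (t : Edge d L → ({f : Edge d L // ¬p f} → Circle) → ℝ)
  (hw : ∀ e i, Measurable fun y => w e y i) (ha : ∀ e i, Measurable fun y => a e y i)
  (hlm : ∀ e i, Measurable fun y => l e y i) (ht : ∀ e, Measurable (t e))
  (hw0 : ∀ e y i, 0 ≤ w e y i) (hw1 : ∀ e y, ∑ i, w e y i = 1) (hl : ∀ e y i, 0 < l e y i)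
  (hol : GaugeConfig d L Circle → Edge d L → Circle → Circle)
  (H : Edge d L → ({f : Edge d L // ¬p f} → Circle) → Circle → Circle)
  (hHV : ∀ (V : GaugeConfig d L Circle) (e : Edge d L), p e → hol V e = H e (fun f => V f))
  (hH : ∀ e y (θ : ℝ), H e y (Circle.exp θ) = Circle.exp (t e y + ∑ i, w e y i * (a e y i +
    ((θ - a e y i) + 2 * arctan ((l e y i - 1) * Real.sin (θ - a e y i) /
      ((1 + l e y i) + (1 - l e y i) * Real.cos (θ - a e y i)))))))
  (j : Edge d L → ({f : Edge d L // ¬p f} → Circle) → Circle → ℝ)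
  (hj : ∀ e y (θ : ℝ), j e y (Circle.exp θ) =
    ∑ i, w e y i * (2 * l e y i / ((1 + l e y i ^ 2) + (1 - l e y i ^ 2) * Real.cos (θ - a e y i))))

include hw ha hlm ht hw0 hw1 hl hHV hH hj

/-- **The engine's `U(1)` NCP-mixture plaquette coupling layer is exact** for `⊗ haarProbability Circle`
with the booked density `Σ_i w_i · 2l_i/((1 + l_i²) + (1 − l_i²) cos(θ_P − a_i))` at the plaquette
angle: any mask/plane with frozen staples, weights nonnegative summing to one, scales positive,
everything measurable in the frozen links. -/
theorem hasJacobian_u1NCPPlaquetteCouplingLayer :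
    HasJacobian (MeasureTheory.Measure.pi fun _ : Edge d L => haarProbability Circle)
      (fun (V : GaugeConfig d L Circle) (e : Edge d L) =>
        if p e then hol V e (plaquetteHolonomy V e.1 e.2 (ν e)) *
          (plaquetteHolonomy V e.1 e.2 (ν e))⁻¹ * V e
        else V e)
      fun V => ENNReal.ofReal (Theory2.coupleJac p (fun b y u =>
        j b.1 y (u * (y ⟨_, h1 b.1 b.2⟩ * (y ⟨_, h2 b.1 b.2⟩)⁻¹ * (y ⟨_, h3 b.1 b.2⟩)⁻¹))) V) :=
  hasJacobian_u1DegreeOnePlaquetteCouplingLayer p ν h1 h2 h3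
    (Φ := fun e y θ => t e y + ∑ i, w e y i * (a e y i + ((θ - a e y i) +
      2 * arctan ((l e y i - 1) * Real.sin (θ - a e y i) /
        ((1 + l e y i) + (1 - l e y i) * Real.cos (θ - a e y i))))))
    (Φ' := fun e y θ => ∑ i, w e y i *
      (2 * l e y i / ((1 + l e y i ^ 2) + (1 - l e y i ^ 2) * Real.cos (θ - a e y i))))
    (fun e y => hasDerivAt_mixture (w e y) (a e y) (t e y) fun i θ => hasDerivAt_ncpLift (hl e y i) θ)
    (fun e y => continuous_finsetSum _ fun i _ => continuous_const.mul
      ((continuous_ncpJac (hl e y i)).comp (continuous_id.sub continuous_const)))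
    (fun e y => mixture_deriv_pos (w e y) (a e y) (hw0 e y) (hw1 e y) fun i θ => ncpJac_pos (hl e y i) θ)
    (fun e y => mixture_add_two_pi (w e y) (a e y) (t e y)
      (Φ := fun i θ => θ + 2 * arctan ((l e y i - 1) * Real.sin θ / ((1 + l e y i) + (1 - l e y i) * Real.cos θ)))
      (fun i θ => ncpLift_add_two_pi (l e y i) θ) (hw1 e y))
    (fun e => measurable_ncpMixture_prod (hw e) (ha e) (hlm e) (ht e))
    (fun e => measurable_ncpMixtureJac_prod (hw e) (ha e) (hlm e))
    hol H hHV hH j hj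

/-- **… and it is a measurable automorphism of `GaugeConfig d L Circle`** with that `HasJacobian`. -/
theorem exists_measurableEquiv_u1NCPPlaquetteCouplingLayer :
    ∃ Ψ : GaugeConfig d L Circle ≃ᵐ GaugeConfig d L Circle,
      (⇑Ψ = fun (V : GaugeConfig d L Circle) (e : Edge d L) =>
        if p e then hol V e (plaquetteHolonomy V e.1 e.2 (ν e)) *
          (plaquetteHolonomy V e.1 e.2 (ν e))⁻¹ * V e
        else V e) ∧
      HasJacobian (MeasureTheory.Measure.pi fun _ : Edge d L => haarProbability Circle) Ψ
        fun V => ENNReal.ofReal (Theory2.coupleJac p (fun b y u =>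
          j b.1 y (u * (y ⟨_, h1 b.1 b.2⟩ * (y ⟨_, h2 b.1 b.2⟩)⁻¹ * (y ⟨_, h3 b.1 b.2⟩)⁻¹))) V) :=
  exists_measurableEquiv_u1DegreeOnePlaquetteCouplingLayer p ν h1 h2 h3
    (Φ := fun e y θ => t e y + ∑ i, w e y i * (a e y i + ((θ - a e y i) +
      2 * arctan ((l e y i - 1) * Real.sin (θ - a e y i) /
        ((1 + l e y i) + (1 - l e y i) * Real.cos (θ - a e y i))))))
    (Φ' := fun e y θ => ∑ i, w e y i *
      (2 * l e y i / ((1 + l e y i ^ 2) + (1 - l e y i ^ 2) * Real.cos (θ - a e y i))))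
    (fun e y => hasDerivAt_mixture (w e y) (a e y) (t e y) fun i θ => hasDerivAt_ncpLift (hl e y i) θ)
    (fun e y => continuous_finsetSum _ fun i _ => continuous_const.mul
      ((continuous_ncpJac (hl e y i)).comp (continuous_id.sub continuous_const)))
    (fun e y => mixture_deriv_pos (w e y) (a e y) (hw0 e y) (hw1 e y) fun i θ => ncpJac_pos (hl e y i) θ)
    (fun e y => mixture_add_two_pi (w e y) (a e y) (t e y)
      (Φ := fun i θ => θ + 2 * arctan ((l e y i - 1) * Real.sin θ / ((1 + l e y i) + (1 - l e y i) * Real.cos θ)))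
      (fun i θ => ncpLift_add_two_pi (l e y i) θ) (hw1 e y))
    (fun e => measurable_ncpMixture_prod (hw e) (ha e) (hlm e) (ht e))
    (fun e => measurable_ncpMixtureJac_prod (hw e) (ha e) (hlm e))
    hol H hHV hH j hj

end NCP

end Summit.Ventures.LatticeQCDFlow.Exactness
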